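import Summits.QuantumFields.YangMills.Theorems.BalabanStepParabolic.Negative.OverTunedGerm
import Summits.QuantumFields.YangMills.Theorems.BalabanStepParabolic.Negative.TorusRegularity
import HarnessLib

/-!
# `BalabanStepParabolic` — negative-side support: over-tuned thin inhabitant III (continuity of the germ modulo
# uniform over-tuned triviality)

Part 3 of 4 (crux `stmt-QuantumFields-9684`, drefute gen 2). `continuous_Efn` (finite-torus `β`-continuity +
`β → ∞` decay from `TorusRegularity`), the dyadic-cover continuity of the main branch off the accumulation
plane, and **`continuous_germMain`** / **`continuous_germC`**: at the accumulation plane `s = 0` of the junk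
Wilson orbits the germ is small because a point where it does not vanish decodes an OVER-TUNED coupling for its
depth (`counting_φJ`), where the hypothesis (uniform over-tuned triviality at slope `κ log M`) applies.
-/

namespace Summit.QuantumFields.YangMills.Theorems.BalabanStepParabolic.Negative

open scoped SchwartzMap
open MeasureTheory Filter Topology
open Literature.MathematicalPhysics.QuantumFieldTheory Literature.MathematicalPhysics.AQFT
open Literature.MathematicalPhysics.QuantumLattice

noncomputable section

/-! ### §5 Continuity of the germ modulo uniform over-tuned triviality -/

section Continuity

variable {G : Type} [Group G] [TopologicalSpace G] [IsTopologicalGroup G] [CompactSpace G]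
  [MeasurableSpace G] [BorelSpace G] (r : LatticeRep G) (M : ℕ) (κ : ℝ)

/-- The transported data on a fixed depth shell tend to `0` as `β → ∞` (finite-torus regularity). [folklore] -/
theorem tendsto_dataW_atTop (S₀ m : ℕ) (h : Fin (m + 1) → 𝓢(EuclideanSpace ℝ (Fin 4), ℝ)) (k : ℕ) :
    Tendsto (dataW r M S₀ (m + 1) h k) atTop (𝓝 0) := by
  unfold dataW
  obtain ⟨Kc, hKc⟩ := abs_curvCorr_le r ((M ^ k * S₀ - 1) / 2) m (fun i => (blockDilate M)^[k] (h i))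
  have hT := (tendsto_expect_wilsonAction r (2 * ((M ^ k * S₀ - 1) / 2) + 1)).const_mul Kc
  rw [mul_zero] at hT
  exact squeeze_zero_norm (fun β => by rw [Real.norm_eq_abs]; exact hKc β) hT

/-- The transported data on a fixed depth shell are continuous in `β`. [folklore] -/
theorem continuous_dataW (S₀ n : ℕ) (h : Fin n → 𝓢(EuclideanSpace ℝ (Fin 4), ℝ)) (k : ℕ) :
    Continuous (dataW r M S₀ n h k) := by
  unfold dataW
  exact continuous_wilsonCentredSchwinger r _ _ _ _

/-- **`E_k` is continuous on `ℝ`** (`κ > 0`, `n ≥ 1`): continuous in `γ > 0` through `β = κ/γ²`, zero for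
`γ ≤ 0`, and `→ 0` as `γ → 0⁺` because `β → ∞` on a fixed torus. [folklore] -/
theorem continuous_Efn (hκ : 0 < κ) (S₀ m : ℕ) (h : Fin (m + 1) → 𝓢(EuclideanSpace ℝ (Fin 4), ℝ)) (k : ℕ) :
    Continuous (Efn r M κ S₀ (m + 1) h k) := by
  have hW := continuous_dataW r M S₀ (m + 1) h k
  have hT := tendsto_dataW_atTop r M S₀ m h k
  rw [continuous_iff_continuousAt]
  intro γ₀
  rcases lt_trichotomy γ₀ 0 with hneg | hzero | hpos
  · have hev : (Efn r M κ S₀ (m + 1) h k) =ᶠ[𝓝 γ₀] fun _ => 0 := by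
      filter_upwards [Iio_mem_nhds hneg] with γ hγ
      simp [Efn, not_lt.2 (le_of_lt (Set.mem_Iio.1 hγ))]
    exact continuousAt_const.congr_of_eventuallyEq hev
  · subst hzero
    have h0 : Efn r M κ S₀ (m + 1) h k 0 = 0 := by simp [Efn]
    rw [continuousAt_iff_continuous_left'_right']
    constructor
    · refine (continuousWithinAt_const (b := (0 : ℝ))).congr (fun γ hγ => ?_) h0
      simp [Efn, not_lt.2 (le_of_lt (Set.mem_Iio.1 hγ))]
    · unfold ContinuousWithinAt
      rw [h0]
      have hdiv : Tendsto (fun γ : ℝ => κ / γ ^ 2) (𝓝[>] 0) atTop := by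
        have h1 : Tendsto (fun γ : ℝ => γ ^ 2) (𝓝[>] (0 : ℝ)) (𝓝[>] 0) := by
          refine tendsto_nhdsWithin_iff.2 ⟨?_, ?_⟩
          · have : Tendsto (fun γ : ℝ => γ ^ 2) (𝓝 (0 : ℝ)) (𝓝 0) := by
              simpa using ((continuous_pow 2).tendsto (0 : ℝ))
            exact this.mono_left nhdsWithin_le_nhds
          · filter_upwards [self_mem_nhdsWithin] with γ hγ using pow_pos (Set.mem_Ioi.1 hγ) 2
        have h2 := (tendsto_inv_nhdsGT_zero.comp h1).const_mul_atTop hκ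
        refine h2.congr fun γ => ?_
        simp [div_eq_mul_inv]
      refine (hT.comp hdiv).congr' ?_
      filter_upwards [self_mem_nhdsWithin] with γ hγ
      simp [Efn, Set.mem_Ioi.1 hγ]
  · have hev : (Efn r M κ S₀ (m + 1) h k) =ᶠ[𝓝 γ₀] fun γ => dataW r M S₀ (m + 1) h k (κ / γ ^ 2) := by
      filter_upwards [Ioi_mem_nhds hpos] with γ hγ
      simp [Efn, Set.mem_Ioi.1 hγ]
    refine ContinuousAt.congr_of_eventuallyEq ?_ hev
    have hne : γ₀ ^ 2 ≠ 0 := by positivity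
    exact hW.continuousAt.comp (continuousAt_const.div (continuousAt_id.pow 2) hne)

/-- The decoded coupling is continuous off `s = 0`. [folklore] -/
theorem continuousAt_γOf {q₀ : ℝ × (ℝ × ℝ)} (hs : q₀.2.1 ≠ 0) : ContinuousAt γOf q₀ := by
  unfold γOf
  refine continuous_clampU.continuousAt.comp ?_
  exact ((continuous_snd.comp continuous_snd).continuousAt).div
    ((continuous_fst.comp continuous_snd).continuousAt) hs

/-- Component bounds from a bound on the sup distance in `ℝ × (ℝ × ℝ)`. [folklore] -/
theorem abs_sub_lt_of_dist_lt {q q₀ : ℝ × (ℝ × ℝ)} {δ : ℝ} (hq : dist q q₀ < δ) :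
    |q.1 - q₀.1| < δ ∧ |q.2.1 - q₀.2.1| < δ ∧ |q.2.2 - q₀.2.2| < δ := by
  rw [Prod.dist_eq, Prod.dist_eq] at hq
  refine ⟨?_, ?_, ?_⟩
  · exact lt_of_le_of_lt (by rw [← Real.dist_eq]; exact le_max_left _ _) hq
  · exact lt_of_le_of_lt (by rw [← Real.dist_eq]; exact (le_max_left _ _).trans (le_max_right _ _)) hq
  · exact lt_of_le_of_lt (by rw [← Real.dist_eq]; exact (le_max_right _ _).trans (le_max_right _ _)) hq

/-- The main branch is dominated by its data factor. [folklore] -/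
theorem abs_germMain_le (S₀ n : ℕ) (h : Fin n → 𝓢(EuclideanSpace ℝ (Fin 4), ℝ)) (q : ℝ × (ℝ × ℝ)) :
    |germMain r M κ S₀ n h q| ≤ |Efn r M κ S₀ n h (kIdx q.2.1) (γOf q)| := by
  unfold germMain
  rw [abs_mul, abs_mul, abs_of_nonneg (shellW_mem _).1, abs_of_nonneg (tentZ_mem _).1]
  have h1 := (shellW_mem q.2.1).2
  have h2 := (tentZ_mem (q.1 - (φJ M)^[kIdx q.2.1] (γOf q))).2
  have h3 := abs_nonneg (Efn r M κ S₀ n h (kIdx q.2.1) (γOf q))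
  calc shellW q.2.1 * tentZ (q.1 - (φJ M)^[kIdx q.2.1] (γOf q)) * |Efn r M κ S₀ n h (kIdx q.2.1) (γOf q)|
      ≤ 1 * 1 * |Efn r M κ S₀ n h (kIdx q.2.1) (γOf q)| := by
        apply mul_le_mul_of_nonneg_right _ h3
        exact mul_le_mul h1 h2 (tentZ_mem _).1 zero_le_one
    _ = _ := by ring

/-- On the window `(13/16, 5/4)·(1/2)^k` the main branch IS the `k`-th expression. [folklore] -/
theorem germMain_eq_germWin {S₀ n : ℕ} {h : Fin n → 𝓢(EuclideanSpace ℝ (Fin 4), ℝ)} {k : ℕ}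
    {q : ℝ × (ℝ × ℝ)} (h1 : 13 / 16 * (1 / 2 : ℝ) ^ k < q.2.1) (h2 : q.2.1 < 5 / 4 * (1 / 2 : ℝ) ^ k) :
    germMain r M κ S₀ n h q = germWin r M κ S₀ n h k q := by
  unfold germMain germWin
  rw [shellW_eq_of_window h1 h2, kIdx_eq_of_window h1 h2]

/-- The `k`-th expression is continuous off `s = 0` (`κ > 0`, `n ≥ 1`). [folklore] -/
theorem continuousAt_germWin (hκ : 0 < κ) (S₀ m : ℕ) (h : Fin (m + 1) → 𝓢(EuclideanSpace ℝ (Fin 4), ℝ))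
    (k : ℕ) {q₀ : ℝ × (ℝ × ℝ)} (hs : q₀.2.1 ≠ 0) : ContinuousAt (germWin r M κ S₀ (m + 1) h k) q₀ := by
  have hγ := continuousAt_γOf hs
  unfold germWin
  refine (ContinuousAt.mul ?_ ?_).mul ?_
  · exact (by fun_prop : Continuous fun q : ℝ × (ℝ × ℝ) => max 0 (1 - 8 * |2 ^ k * q.2.1 - 1|)).continuousAt
  · exact continuous_tentZ.continuousAt.comp
      (continuous_fst.continuousAt.sub (((continuous_φJ M).iterate k).continuousAt.comp hγ))
  · exact (continuous_Efn r M κ hκ S₀ m h k).continuousAt.comp hγ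

/-- **Continuity of the main branch** modulo uniform over-tuned triviality at slope `B = κ log M`
for the (off-diagonal) tuple in hand. [folklore] -/
theorem continuous_germMain (hM : 2 ≤ M) (hκ : 0 < κ) (S₀ m : ℕ)
    (h : Fin (m + 1) → 𝓢(EuclideanSpace ℝ (Fin 4), ℝ))
    (hUOT : ∀ (B' ε : ℝ), 0 < ε → ∃ k₀ : ℕ, ∀ k ≥ k₀, ∀ β : ℝ, κ * Real.log M * k - B' ≤ β →
      |dataW r M S₀ (m + 1) h k β| ≤ ε) :
    Continuous (germMain r M κ S₀ (m + 1) h) := by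
  have hlog : 0 < Real.log M := Real.log_pos (by exact_mod_cast hM)
  rw [continuous_iff_continuousAt]
  rintro ⟨x₀, s₀, w₀⟩
  rcases lt_trichotomy s₀ 0 with hneg | hzero | hpos
  · -- s < 0 : locally zero
    have hev : germMain r M κ S₀ (m + 1) h =ᶠ[𝓝 (x₀, s₀, w₀)] fun _ => 0 := by
      have hopen : IsOpen {q : ℝ × (ℝ × ℝ) | q.2.1 < 0} :=
        isOpen_lt (continuous_fst.comp continuous_snd) continuous_const
      filter_upwards [hopen.mem_nhds (by exact hneg)] with q hq
      have : shellW q.2.1 = 0 := by unfold shellW; rw [if_neg (not_lt.2 (le_of_lt hq))]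
      simp [germMain, this]
    exact continuousAt_const.congr_of_eventuallyEq hev
  · -- s = 0 : the accumulation plane
    subst hzero
    have hval : germMain r M κ S₀ (m + 1) h (x₀, 0, w₀) = 0 := by
      have : shellW (0 : ℝ) = 0 := by unfold shellW; rw [if_neg (lt_irrefl 0)]
      simp [germMain, this]
    rw [Metric.continuousAt_iff]
    intro ε hε
    rcases lt_trichotomy w₀ 0 with hwneg | hwzero | hwpos
    · -- w₀ < 0 : decoded coupling is 0 nearby
      refine ⟨-w₀ / 2, by linarith, fun q hq => ?_⟩
      obtain ⟨-, hs, hw⟩ := abs_sub_lt_of_dist_lt hq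
      rw [hval, dist_zero_right]
      simp only [sub_zero] at hs
      have hw' : q.2.2 < w₀ / 2 := by linarith [(abs_lt.1 hw).2]
      by_cases hqs : q.2.1 ≤ 0
      · have : shellW q.2.1 = 0 := by unfold shellW; rw [if_neg (not_lt.2 hqs)]
        simp [germMain, this, hε]
      · rw [not_le] at hqs
        have hγ : γOf q = 0 := clampU_of_nonpos (div_nonpos_of_nonpos_of_nonneg (by linarith) hqs.le)
        have : Efn r M κ S₀ (m + 1) h (kIdx q.2.1) (γOf q) = 0 := by rw [hγ]; simp [Efn]
        simp [germMain, this, hε]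
    · -- w₀ = 0 : over-tuned data, small by UOT
      subst hwzero
      set T : ℝ := |x₀| + 2 with hT
      obtain ⟨N, hN⟩ := pow_unbounded_of_one_lt (3 * Real.log M * T ^ 2) (by norm_num : (1 : ℝ) < 16 / 9)
      obtain ⟨k₀, hk₀⟩ := hUOT (κ * Real.log M * N) (ε / 2) (by positivity)
      refine ⟨min 1 (3 / 4 * (1 / 2 : ℝ) ^ k₀), lt_min one_pos (by positivity), fun q hq => ?_⟩
      obtain ⟨hx, hs, -⟩ := abs_sub_lt_of_dist_lt hq
      rw [hval, dist_zero_right]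
      simp only [sub_zero] at hs
      by_cases hqs : q.2.1 ≤ 0
      · have : shellW q.2.1 = 0 := by unfold shellW; rw [if_neg (not_lt.2 hqs)]
        simp [germMain, this, hε]
      rw [not_le] at hqs
      have hk : k₀ < kIdx q.2.1 := lt_kIdx_of_small hqs ((abs_lt.1 hs).2.trans_le (min_le_right _ _))
      by_cases hγ0 : 0 < γOf q
      swap
      · have : Efn r M κ S₀ (m + 1) h (kIdx q.2.1) (γOf q) = 0 := by simp [Efn, hγ0]
        simp [germMain, this, hε]
      by_cases htent : 1 ≤ |q.1 - (φJ M)^[kIdx q.2.1] (γOf q)|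
      · simp [germMain, tentZ_eq_zero htent, hε]
      rw [not_le] at htent
      refine lt_of_le_of_lt (abs_germMain_le r M κ S₀ (m + 1) h q) ?_
      -- the orbit has not passed `T`, so the decoded coupling is over-tuned for its depth
      have hxT : (φJ M)^[kIdx q.2.1] (γOf q) ≤ T := by
        have hx1 : |q.1 - x₀| < 1 := hx.trans_le (min_le_left _ _)
        have h1 := (abs_lt.1 htent).1
        have h2 := (abs_lt.1 hx1).2
        rw [hT]; linarith [le_abs_self x₀]
      have hcount := counting_φJ M hlog hN (kIdx q.2.1) (γOf q) hγ0 hxT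
      have hβ : κ * Real.log M * (kIdx q.2.1) - κ * Real.log M * N ≤ κ / (γOf q) ^ 2 := by
        have h1 := mul_le_mul_of_nonneg_left hcount hκ.le
        have e : κ * (1 / γOf q ^ 2 + Real.log M * N) = κ / γOf q ^ 2 + κ * Real.log M * N := by ring
        rw [e] at h1
        linarith
      have hdat := hk₀ (kIdx q.2.1) hk.le (κ / (γOf q) ^ 2) hβ
      have hE : Efn r M κ S₀ (m + 1) h (kIdx q.2.1) (γOf q) =
          dataW r M S₀ (m + 1) h (kIdx q.2.1) (κ / (γOf q) ^ 2) := by simp [Efn, hγ0]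
      rw [hE]
      linarith
    · -- w₀ > 0 : decoded coupling is 1 nearby and the localiser is off (φ^k(1) → ∞)
      obtain ⟨k₁, hk₁⟩ := exists_nat_gt ((|x₀| + 2) / Real.log M)
      refine ⟨min 1 (min (w₀ / 2) (3 / 4 * (1 / 2 : ℝ) ^ k₁)), lt_min one_pos (lt_min (by linarith) (by positivity)),
        fun q hq => ?_⟩
      obtain ⟨hx, hs, hw⟩ := abs_sub_lt_of_dist_lt hq
      rw [hval, dist_zero_right]
      simp only [sub_zero] at hs
      by_cases hqs : q.2.1 ≤ 0
      · have : shellW q.2.1 = 0 := by unfold shellW; rw [if_neg (not_lt.2 hqs)]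
        simp [germMain, this, hε]
      rw [not_le] at hqs
      have hδw : min 1 (min (w₀ / 2) (3 / 4 * (1 / 2 : ℝ) ^ k₁)) ≤ w₀ / 2 := (min_le_right _ _).trans (min_le_left _ _)
      have hs' : q.2.1 < w₀ / 2 := (abs_lt.1 hs).2.trans_le hδw
      have hw' : w₀ / 2 < q.2.2 := by linarith [(abs_lt.1 hw).1]
      have hγ : γOf q = 1 := by
        refine clampU_of_one_le ?_
        rw [le_div_iff₀ hqs]; linarith
      have hk : k₁ < kIdx q.2.1 :=
        lt_kIdx_of_small hqs ((abs_lt.1 hs).2.trans_le ((min_le_right _ _).trans (min_le_right _ _)))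
      have hbig : |x₀| + 2 < (φJ M)^[kIdx q.2.1] 1 := by
        have h1 : |x₀| + 2 < 1 + k₁ * Real.log M := by
          rw [div_lt_iff₀ hlog] at hk₁; linarith
        have h2 := iterate_φJ_one_ge M hlog.le k₁
        have h3 := iterate_φJ_mono M hlog.le zero_le_one hk.le
        linarith
      have htent : tentZ (q.1 - (φJ M)^[kIdx q.2.1] (γOf q)) = 0 := by
        refine tentZ_eq_zero ?_
        rw [hγ]
        have hx' : q.1 < x₀ + 1 := by linarith [(abs_lt.1 hx).2, min_le_left (1 : ℝ) (min (w₀ / 2) (3 / 4 * (1 / 2 : ℝ) ^ k₁))]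
        rw [abs_of_neg (by linarith [le_abs_self x₀])]
        linarith [le_abs_self x₀]
      simp [germMain, htent, hε]
  · -- s > 0 : dyadic cover
    by_cases hlarge : 9 / 8 < s₀
    · have hev : germMain r M κ S₀ (m + 1) h =ᶠ[𝓝 (x₀, s₀, w₀)] fun _ => 0 := by
        have hopen : IsOpen {q : ℝ × (ℝ × ℝ) | 9 / 8 < q.2.1} :=
          isOpen_lt continuous_const (continuous_fst.comp continuous_snd)
        filter_upwards [hopen.mem_nhds (by exact hlarge)] with q hq
        simp [germMain, shellW_eq_zero_of_large hq]
      exact continuousAt_const.congr_of_eventuallyEq hev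
    · rw [not_lt] at hlarge
      obtain ⟨k, hk1, hk2⟩ := exists_band hpos (lt_of_le_of_lt hlarge (by norm_num))
      by_cases hgap : s₀ < 7 / 8 * (1 / 2 : ℝ) ^ k
      · have hev : germMain r M κ S₀ (m + 1) h =ᶠ[𝓝 (x₀, s₀, w₀)] fun _ => 0 := by
          have hopen : IsOpen {q : ℝ × (ℝ × ℝ) | 9 / 16 * (1 / 2 : ℝ) ^ k < q.2.1 ∧ q.2.1 < 7 / 8 * (1 / 2 : ℝ) ^ k} :=
            (isOpen_lt continuous_const (continuous_fst.comp continuous_snd)).inter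
              (isOpen_lt (continuous_fst.comp continuous_snd) continuous_const)
          filter_upwards [hopen.mem_nhds (by exact ⟨hk1, hgap⟩)] with q hq
          simp [germMain, shellW_eq_zero_of_gap hq.1 hq.2]
        exact continuousAt_const.congr_of_eventuallyEq hev
      · rw [not_lt] at hgap
        have hw1 : 13 / 16 * (1 / 2 : ℝ) ^ k < s₀ := lt_of_lt_of_le (by
          have : (0:ℝ) < (1 / 2 : ℝ) ^ k := by positivity
          nlinarith) hgap
        have hev : germMain r M κ S₀ (m + 1) h =ᶠ[𝓝 (x₀, s₀, w₀)] germWin r M κ S₀ (m + 1) h k := by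
          have hopen : IsOpen {q : ℝ × (ℝ × ℝ) | 13 / 16 * (1 / 2 : ℝ) ^ k < q.2.1 ∧ q.2.1 < 5 / 4 * (1 / 2 : ℝ) ^ k} :=
            (isOpen_lt continuous_const (continuous_fst.comp continuous_snd)).inter
              (isOpen_lt (continuous_fst.comp continuous_snd) continuous_const)
          filter_upwards [hopen.mem_nhds (by exact ⟨hw1, hk2⟩)] with q hq
          exact germMain_eq_germWin r M κ hq.1 hq.2
        exact (continuousAt_germWin r M κ hκ S₀ m h k (by simp; exact hpos.ne')).congr_of_eventuallyEq hev

/-- **Continuity of the germ** (every species string, every base torus, every tuple whose over-tuned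
data decay): constant branches are constant, the main branch is `continuous_germMain`. [folklore] -/
theorem continuous_germC (hM : 2 ≤ M) (hκ : 0 < κ) (n : ℕ) (σ : Fin n → YMSpecies G) (S₀ : ℕ)
    (h : Fin n → 𝓢(EuclideanSpace ℝ (Fin 4), ℝ))
    (hUOT : n ≠ 0 → Odd S₀ → ∀ (B' ε : ℝ), 0 < ε → ∃ k₀ : ℕ, ∀ k ≥ k₀, ∀ β : ℝ,
      κ * Real.log M * k - B' ≤ β → |dataW r M S₀ n h k β| ≤ ε) :
    Continuous fun q => germC r M κ n σ q S₀ h := by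
  classical
  by_cases hσ : ∀ i, σ i = r.curvature
  · by_cases hodd : Odd S₀
    · cases n with
      | zero =>
        have : (fun q => germC r M κ 0 σ q S₀ h) = fun _ => 1 := by
          funext q; unfold germC; rw [if_pos hσ, if_pos hodd, if_pos rfl]
        rw [this]; exact continuous_const
      | succ m =>
        have : (fun q => germC r M κ (m + 1) σ q S₀ h) = germMain r M κ S₀ (m + 1) h := by
          funext q; unfold germC germMain; rw [if_pos hσ, if_pos hodd, if_neg (Nat.succ_ne_zero m)]
        rw [this]
        exact continuous_germMain r M κ hM hκ S₀ m h (hUOT (Nat.succ_ne_zero m) hodd)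
    · have : (fun q => germC r M κ n σ q S₀ h) = fun _ => 0 := by
        funext q; unfold germC; rw [if_pos hσ, if_neg hodd]
      rw [this]; exact continuous_const
  · have : (fun q => germC r M κ n σ q S₀ h) = fun _ => 0 := by
      funext q; unfold germC; rw [if_neg hσ]
    rw [this]; exact continuous_const

end Continuity

end

end Summit.QuantumFields.YangMills.Theorems.BalabanStepParabolic.Negative
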